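import Literature.NumberTheory.Transcendental.LinGroupZEBezout
import Literature.AlgebraicGeometry.Resolution.CohenMacaulayAvoidance
import Mathlib.RingTheory.RegularLocalRing.Polynomial
import Mathlib.RingTheory.Ideal.KrullsHeightTheorem
import Mathlib.GroupTheory.CosetCover
import HarnessLib

/-!
# Philippon's zero estimate on `𝔾ₐ^{d₀} × 𝔾ₘ^{d₁}`: Hilbert functions of non-zero-divisors, components at a prime, Cohen–Macaulay regularity, the chain of generic cuts

## Philippon's zero estimate on `𝔾ₐ^{d₀} × 𝔾ₘ^{d₁}`: Hilbert-function bookkeeping for non-zero-divisors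

Topic `Literature/NumberTheory/Transcendental`. Port to `LinGroup d₀ d₁` (index `Fin d₀ ⊕ Fin d₁`)
of the tree's `PhilipponZeroEstimateHilbert.lean` (the case `d₀ = 1`), for the zero estimate owed
to `Literature.Barriers.Schanuel.roy1992_thm1`. It extends the Hilbert-function toolkit of
`LinGroupZEBezout.lean` (box filtration `Box(t)`, `H_N(t) = LinGroup.hilbI D₀ D₁ N t`) from
primes to **non-zero-divisors modulo an arbitrary ideal**, which is what the multiplicity version
of Roy's Prop. 2.2 / Thm. 4.1 (LNM 1752, Ch. 11) needs, and proves a **Bézout-type upper bound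
with a lossy constant** for chains of ideals cut out by successive non-zero-divisors of box degree
`1` — sufficient for Philippon's theorem, whose constant `c` only has to depend on `d₀, d₁`. PROVED:

* `IsNZDMod J Q` (`Q f ∈ J ⇒ f ∈ J`); `map_mulLeft_inf_of_nzd`, `finrank_mulShift_of_nzd`;
* `hilbI_sup_span_add_le_of_nzd` — the section inequality `H_{J+(Q)}(t) + H_J(t-1) ≤ H_J(t)`
  for `Q ∈ Box(1)` a non-zero-divisor modulo `J`;
* `hilbI_add_le_hilbI_inf_of_nzd` — additivity `H_N(t) + H_J(t-δ) ≤ H_{N ∩ J}(t)` for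
  `a ∈ N ∩ Box(δ)` a non-zero-divisor modulo `J`;
* `hilbI_le_of_sum_le` — the doubling trick `(t+1) H'(t) ≤ ∑_{s ≤ 2t+1} H'(s)` (monotonicity);
* **`hilbI_chain_le`** — if `𝔍₀ ≤ 𝔍₁ ≤ ⋯` with `𝔍_{j} + (Q_{j+1}) ≤ 𝔍_{j+1}` and `Q_{j+1} ∈ Box(1)`
  a non-zero-divisor modulo `𝔍_j`, then `H_{𝔍_j}(t) ≤ 2^{dj} D₀^{d₀} D₁^{d₁} (t+1)^{d-j}` (`j ≤ d = d₀+d₁`).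

## Philippon's zero estimate on `𝔾ₐ^{d₀} × 𝔾ₘ^{d₁}`: components of an ideal at a prime, thick additivity

Topic `Literature/NumberTheory/Transcendental`. Port to `LinGroup d₀ d₁` (index `Fin d₀ ⊕ Fin d₁`)
of the tree's `PhilipponZeroEstimateLoc.lean` (the case `d₀ = 1`), for the zero estimate owed to
`Literature.Barriers.Schanuel.roy1992_thm1`. Roy's proof of Thm. 4.1 (LNM 1752,
Ch. 11) compares the Hilbert function of the special ideal `𝔄` with those of its primary
components `𝔮(𝒱)` at the top-dimensional components `𝒱` (Prop. 3.8 (95)–(97), §2.2 (ii)). We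
avoid primary decomposition: for a prime `𝔭` and an ideal `I`, the **component of `I` at `𝔭`** is
the elementary ideal `LinGroup.loc 𝔭 h𝔭 I = I·B_𝔭 ∩ B = {f ; ∃ P ∉ 𝔭, P f ∈ I}` (Roy's
`𝔮(𝒱) = I·𝒪(G)_𝔭 ∩ 𝒪(G)`, Prop. 3.8 Step 1), and everything needed about it is PROVED directly:

* `le_loc`, `loc_mono`, `loc_loc`, `loc_le` (`I ≤ 𝔭 ⇒ loc 𝔭 I ≤ 𝔭`), `isNZDMod_loc`
  (elements outside `𝔭` are non-zero-divisors modulo `loc 𝔭 I`), `isNZDMod_finsetInf`,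
  `pow_mem_loc`;
* **`exists_sum_hilbI_loc_le`** — thick additivity: for a finite family of pairwise incomparable
  primes `𝔭ᵢ ⊇ I` with `𝔭ᵢ^M ≤ loc 𝔭ᵢ I` (i.e. `𝔭ᵢ` minimal over `I`), there is a shift `δ` with
  `∑ᵢ H_{loc 𝔭ᵢ I}(t - δ) ≤ H_{⋂ᵢ loc 𝔭ᵢ I}(t)` for `t ≥ δ` — §2.2 (ii) "`deg I = ∑ deg 𝔮ᵢ`" in
  the inequality form the zero estimate uses, for the box filtration (`LinGroup.hilbI` of
  `LinGroupZEBezout.lean`; non-zero-divisor additivity from `…Hilbert.lean`).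

## Philippon's zero estimate on `𝔾ₐ^{d₀} × 𝔾ₘ^{d₁}`: non-zero-divisors from the Cohen–Macaulay property

Topic `Literature/NumberTheory/Transcendental`. Port to `LinGroup d₀ d₁` (index `Fin d₀ ⊕ Fin d₁`)
of the tree's `PhilipponZeroEstimateRegular.lean` (the case `d₀ = 1`), for the zero estimate owed to
`Literature.Barriers.Schanuel.roy1992_thm1`. Roy's Prop. 2.2 (LNM 1752, Ch. 11,
pp. 202–204) cuts `G` by successive generic members `Q₁, Q₂, …` of the linear system generating the
special ideal and needs each `Q_{j+1}` to be a non-zero-divisor modulo `(Q₁, …, Q_j)` *locally at the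
points of `G`* — the printed proof invokes the non-singularity of `G`, Krull's theorem and
I. S. Cohen's unmixedness theorem in the regular local rings `ℂ[X]_M`. Here, for
`B = ℂ[X₁, …, X_{d₀}, Y₁, …, Y_{d₁}]` and a prime `𝔭`, we PROVE the form used by the multiplicity estimate:

* **`isNZDMod_loc_ofList`** — if `Q₁, …, Q_k ∈ 𝔭` and each `Q_{l+1}` lies outside every minimal
  prime `𝔭' ⊆ 𝔭` of `(Q₁, …, Q_l)`, then `Q_{l+1}` is a non-zero-divisor modulo the component
  `LinGroup.loc 𝔭 (Q₁, …, Q_l)` (`…Loc.lean`). Proof: `B_𝔭` is a regular local ring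
  (`MvPolynomial.isRegularRing_of_isRegularRing`), hence Cohen–Macaulay
  (`exists_isRegular_length_eq_ringKrullDim`), so `Q` is `B_𝔭`-regular by
  `isRegular_of_forall_notMem_minimalPrimes` (`CohenMacaulayAvoidance.lean`), the avoidance
  hypothesis passing to `B_𝔭` through `IsLocalization.minimalPrimes_map`; regularity in `B_𝔭`
  is exactly the non-zero-divisor property modulo `loc 𝔭`.

## Philippon's zero estimate on `𝔾ₐ^{d₀} × 𝔾ₘ^{d₁}`: the chain of generic cuts (lossy Prop. 2.2)

Topic `Literature/NumberTheory/Transcendental`. Port to `LinGroup d₀ d₁` (index `Fin d₀ ⊕ Fin d₁`)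
of the tree's `PhilipponZeroEstimateChain.lean` (the case `d₀ = 1`), for the zero estimate owed to
`Literature.Barriers.Schanuel.roy1992_thm1`: the construction in D. Roy's proof
of Prop. 2.2 (Nesterenko–Philippon (eds.), LNM 1752, Ch. 11, pp. 202–204) of successive generic
members `Q₁, …, Q_r` of the linear system `span F` generating a special ideal, each a
non-zero-divisor modulo the ideal cut out by the previous ones *at the relevant points of `G`*,
combined with the lossy Bézout bound of `…Hilbert.lean`. Setting: finitely many primes `𝔭ᵢ ∌ u`
of `B = ℂ[X₁, …, X_{d₀}, Y₁, …, Y_{d₁}]` (the top components in `Σ + H`), a finite `F ⊆ Box(1) ∩ ⋂ 𝔭ᵢ`, and the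
dimension hypothesis "every prime `𝔭' ∌ u` containing `F` has height `≥ r`" (all components of
`Z(F) ∩ G` have codimension `≥ r`). PROVED:

* `exists_mem_forall_notMem_of_not_subset` — a subspace not contained in any of finitely many
  primes has an element outside all of them (`ℂ` is infinite; `Subspace.exists_eq_top_of_iUnion_eq_univ`);
* `exists_list_avoids` — the generic sequence `Q₁, …, Q_r ∈ span F` with each `Q_{j+1}` outside
  the minimal primes `𝔭' ⊆ 𝔭ᵢ` of `(Q₁, …, Q_j)` (these have height `≤ j < r` by Krull's height
  theorem, so cannot contain `F`);
* **`exists_ideal_hilbI_le`** — an ideal `𝔍 ≤ loc 𝔭ᵢ (F)` for all `i` with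
  `H_𝔍(t) ≤ 2^{dr} D₀^{d₀}D₁^{d₁} (t+1)^{d-r}` for all `t` (`hilbI_chain_le` along
  `𝔍_j = ⋂ᵢ loc 𝔭ᵢ (Q₁, …, Q_j)`, the non-zero-divisor property coming from `isNZDMod_loc_ofList`,
  i.e. from the Cohen–Macaulay property of the `B_{𝔭ᵢ}`).

## References

* Yu. V. Nesterenko, P. Philippon (eds.), *Introduction to Algebraic Independence Theory*,
  LNM 1752, Springer 2001, Ch. 11 (D. Roy), §2.2 (iii) (Bézout's Lemma), Prop. 2.2.
* P. Philippon, *Lemmes de zéros dans les groupes algébriques commutatifs*, Bull. Soc. Math.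
  France 114 (1986), 355–383, Prop. 3.3.
  LNM 1752, Springer 2001, Ch. 11 (D. Roy), §2.2 (ii), §2.3 (86), Prop. 3.8 Step 1.
  France 114 (1986), 355–383, §3.
  LNM 1752, Springer 2001, Ch. 11 (D. Roy), Prop. 2.2 (proof, pp. 203–204).
* H. Matsumura, *Commutative Ring Theory*, CUP 1986, Thms. 17.4, 17.8.
  LNM 1752, Springer 2001, Ch. 11 (D. Roy), Prop. 2.2 (pp. 202–204), §2.2 (iii).
-/
noncomputable section

open MvPolynomial Module

namespace Literature.NumberTheory.Transcendental

namespace LinGroup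

variable {d₀ d₁ : ℕ} {D₀ D₁ : ℕ}

/-- `Q` is a non-zero-divisor modulo the ideal `J`: `Q f ∈ J ⇒ f ∈ J`. [folklore] -/
def IsNZDMod (J : Ideal (MvPolynomial (Fin d₀ ⊕ Fin d₁) ℂ)) (Q : MvPolynomial (Fin d₀ ⊕ Fin d₁) ℂ) : Prop :=
  ∀ f : MvPolynomial (Fin d₀ ⊕ Fin d₁) ℂ, Q * f ∈ J → f ∈ J

/-- A non-zero-divisor modulo a proper ideal is non-zero. [folklore] -/
theorem IsNZDMod.ne_zero {J : Ideal (MvPolynomial (Fin d₀ ⊕ Fin d₁) ℂ)} {Q : MvPolynomial (Fin d₀ ⊕ Fin d₁) ℂ}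
    (h : IsNZDMod J Q) (hJ : J ≠ ⊤) : Q ≠ 0 := by
  rintro rfl
  exact hJ ((Ideal.eq_top_iff_one _).mpr (h 1 (by simp)))

/-- Outside a prime one is a non-zero-divisor modulo it. [folklore] -/
theorem isNZDMod_of_isPrime {𝔭 : Ideal (MvPolynomial (Fin d₀ ⊕ Fin d₁) ℂ)} (h𝔭 : 𝔭.IsPrime)
    {Q : MvPolynomial (Fin d₀ ⊕ Fin d₁) ℂ} (hQ : Q ∉ 𝔭) : IsNZDMod 𝔭 Q :=
  fun _ h => (h𝔭.mem_or_mem h).resolve_left hQ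

/-- `(a·M) ∩ J = a·(M ∩ J)` for `a` a non-zero-divisor modulo `J`. [folklore] -/
theorem map_mulLeft_inf_of_nzd {J : Ideal (MvPolynomial (Fin d₀ ⊕ Fin d₁) ℂ)} {a : MvPolynomial (Fin d₀ ⊕ Fin d₁) ℂ}
    (ha : IsNZDMod J a) (M : Submodule ℂ (MvPolynomial (Fin d₀ ⊕ Fin d₁) ℂ)) :
    M.map (LinearMap.mulLeft ℂ a) ⊓ J.restrictScalars ℂ = (M ⊓ J.restrictScalars ℂ).map (LinearMap.mulLeft ℂ a) := by
  ext x
  simp only [Submodule.mem_inf, Submodule.mem_map, LinearMap.mulLeft_apply, Submodule.restrictScalars_mem]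
  constructor
  · rintro ⟨⟨v, hv, rfl⟩, hx⟩
    exact ⟨v, ⟨hv, ha v hx⟩, rfl⟩
  · rintro ⟨v, ⟨hv, hvJ⟩, rfl⟩
    exact ⟨⟨v, hv, rfl⟩, J.mul_mem_left a hvJ⟩

/-- The dimension identity `dim(a·Box(t-δ) + Box(t) ∩ J) + dim(Box(t-δ) ∩ J) =
dim Box(t-δ) + dim(Box(t) ∩ J)` for `a ∈ Box(δ)` a non-zero-divisor modulo `J ≠ (1)`. [folklore] -/
theorem finrank_mulShift_of_nzd {J : Ideal (MvPolynomial (Fin d₀ ⊕ Fin d₁) ℂ)} (hJ : J ≠ ⊤)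
    {a : MvPolynomial (Fin d₀ ⊕ Fin d₁) ℂ} {δ : ℕ} (haB : a ∈ Box (d₀ := d₀) (d₁ := d₁) D₀ D₁ δ) (ha : IsNZDMod J a)
    {t : ℕ} (ht : δ ≤ t) :
    finrank ℂ ↥((Box (d₀ := d₀) (d₁ := d₁) D₀ D₁ (t - δ)).map (LinearMap.mulLeft ℂ a) ⊔ (Box D₀ D₁ t ⊓ J.restrictScalars ℂ)) +
      finrank ℂ ↥(Box (d₀ := d₀) (d₁ := d₁) D₀ D₁ (t - δ) ⊓ J.restrictScalars ℂ) =
    finrank ℂ ↥(Box (d₀ := d₀) (d₁ := d₁) D₀ D₁ (t - δ)) + finrank ℂ ↥(Box (d₀ := d₀) (d₁ := d₁) D₀ D₁ t ⊓ J.restrictScalars ℂ) := by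
  have ha0 : a ≠ 0 := ha.ne_zero hJ
  have h1 := Submodule.finrank_sup_add_finrank_inf_eq
    ((Box (d₀ := d₀) (d₁ := d₁) D₀ D₁ (t - δ)).map (LinearMap.mulLeft ℂ a)) (Box D₀ D₁ t ⊓ J.restrictScalars ℂ)
  have hle : (Box (d₀ := d₀) (d₁ := d₁) D₀ D₁ (t - δ)).map (LinearMap.mulLeft ℂ a) ≤ Box D₀ D₁ t := by
    have := map_mulLeft_Box_le (d₀ := d₀) (d₁ := d₁) (s := t - δ) haB
    rwa [Nat.sub_add_cancel ht] at this
  have hinf : (Box (d₀ := d₀) (d₁ := d₁) D₀ D₁ (t - δ)).map (LinearMap.mulLeft ℂ a) ⊓ (Box D₀ D₁ t ⊓ J.restrictScalars ℂ) =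
      (Box (d₀ := d₀) (d₁ := d₁) D₀ D₁ (t - δ) ⊓ J.restrictScalars ℂ).map (LinearMap.mulLeft ℂ a) := by
    rw [← inf_assoc, inf_eq_left.mpr hle, map_mulLeft_inf_of_nzd ha]
  rw [hinf, finrank_map_mulLeft ha0, finrank_map_mulLeft ha0] at h1
  omega

/-- **The section inequality for a non-zero-divisor**: `Q ∈ Box(1)` a non-zero-divisor modulo
`J ≠ (1)`, `t ≥ 1` ⇒ `H_{J+(Q)}(t) + H_J(t-1) ≤ H_J(t)` (LNM 1752, Ch. 11, §2.2 (iii), read for the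
box filtration). [cite: NesterenkoPhilippon2001, Ch. 11 §2.2 (iii)] -/
theorem hilbI_sup_span_add_le_of_nzd {J : Ideal (MvPolynomial (Fin d₀ ⊕ Fin d₁) ℂ)} (hJ : J ≠ ⊤)
    {Q : MvPolynomial (Fin d₀ ⊕ Fin d₁) ℂ} (hQB : Q ∈ Box (d₀ := d₀) (d₁ := d₁) D₀ D₁ 1) (hQ : IsNZDMod J Q) {t : ℕ} (ht : 1 ≤ t) :
    hilbI (d₀ := d₀) (d₁ := d₁) D₀ D₁ ((J ⊔ Ideal.span {Q}).restrictScalars ℂ) t + hilbI D₀ D₁ (J.restrictScalars ℂ) (t - 1) ≤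
      hilbI D₀ D₁ (J.restrictScalars ℂ) t := by
  have key := finrank_mulShift_of_nzd (D₀ := D₀) (D₁ := D₁) hJ hQB hQ ht
  have hle : (Box (d₀ := d₀) (d₁ := d₁) D₀ D₁ (t - 1)).map (LinearMap.mulLeft ℂ Q) ⊔ (Box D₀ D₁ t ⊓ J.restrictScalars ℂ) ≤
      Box D₀ D₁ t ⊓ (J ⊔ Ideal.span {Q}).restrictScalars ℂ := by
    refine sup_le ?_ (inf_le_inf_left _ fun x hx => Ideal.mem_sup_left hx)
    have h1 : (Box (d₀ := d₀) (d₁ := d₁) D₀ D₁ (t - 1)).map (LinearMap.mulLeft ℂ Q) ≤ Box D₀ D₁ t := by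
      have := map_mulLeft_Box_le (d₀ := d₀) (d₁ := d₁) (s := t - 1) hQB
      rwa [Nat.sub_add_cancel ht] at this
    refine le_inf h1 ?_
    rintro _ ⟨v, -, rfl⟩
    exact Ideal.mem_sup_right (Ideal.mem_span_singleton.mpr (dvd_mul_right Q v))
  have h2 := Submodule.finrank_mono hle
  have h3 := hilbI_add_finrank_inf (d₀ := d₀) (d₁ := d₁) (D₀ := D₀) (D₁ := D₁) ((J ⊔ Ideal.span {Q}).restrictScalars ℂ) t
  have h4 := hilbI_add_finrank_inf (d₀ := d₀) (d₁ := d₁) (D₀ := D₀) (D₁ := D₁) (J.restrictScalars ℂ) t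
  have h5 := hilbI_add_finrank_inf (d₀ := d₀) (d₁ := d₁) (D₀ := D₀) (D₁ := D₁) (J.restrictScalars ℂ) (t - 1)
  omega

/-- **Additivity for a non-zero-divisor**: for a subspace `N` closed under multiplication, an ideal
`J ≠ (1)` and `a ∈ N ∩ Box(δ)` a non-zero-divisor modulo `J`, `t ≥ δ`:
`H_N(t) + H_J(t-δ) ≤ H_{N ∩ J}(t)`. [folklore] -/
theorem hilbI_add_le_hilbI_inf_of_nzd {N : Submodule ℂ (MvPolynomial (Fin d₀ ⊕ Fin d₁) ℂ)}
    {J : Ideal (MvPolynomial (Fin d₀ ⊕ Fin d₁) ℂ)} (hJ : J ≠ ⊤)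
    {a : MvPolynomial (Fin d₀ ⊕ Fin d₁) ℂ} {δ : ℕ} (haB : a ∈ Box (d₀ := d₀) (d₁ := d₁) D₀ D₁ δ) (haN : a ∈ N)
    (hN : ∀ (x y : MvPolynomial (Fin d₀ ⊕ Fin d₁) ℂ), y ∈ N → x * y ∈ N) (ha : IsNZDMod J a) {t : ℕ} (ht : δ ≤ t) :
    hilbI (d₀ := d₀) (d₁ := d₁) D₀ D₁ N t + hilbI D₀ D₁ (J.restrictScalars ℂ) (t - δ) ≤
      hilbI D₀ D₁ (N ⊓ J.restrictScalars ℂ) t := by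
  have key := finrank_mulShift_of_nzd (D₀ := D₀) (D₁ := D₁) hJ haB ha ht
  have h1 := Submodule.finrank_sup_add_finrank_inf_eq (Box (d₀ := d₀) (d₁ := d₁) D₀ D₁ t ⊓ N) (Box D₀ D₁ t ⊓ J.restrictScalars ℂ)
  have hinf : Box (d₀ := d₀) (d₁ := d₁) D₀ D₁ t ⊓ N ⊓ (Box D₀ D₁ t ⊓ J.restrictScalars ℂ) =
      Box D₀ D₁ t ⊓ (N ⊓ J.restrictScalars ℂ) := by
    rw [inf_inf_inf_comm, inf_idem]
  rw [hinf] at h1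
  have hle : (Box (d₀ := d₀) (d₁ := d₁) D₀ D₁ (t - δ)).map (LinearMap.mulLeft ℂ a) ⊔ (Box D₀ D₁ t ⊓ J.restrictScalars ℂ) ≤
      (Box D₀ D₁ t ⊓ N) ⊔ (Box D₀ D₁ t ⊓ J.restrictScalars ℂ) := by
    refine sup_le_sup_right ?_ _
    have h1 : (Box (d₀ := d₀) (d₁ := d₁) D₀ D₁ (t - δ)).map (LinearMap.mulLeft ℂ a) ≤ Box D₀ D₁ t := by
      have := map_mulLeft_Box_le (d₀ := d₀) (d₁ := d₁) (s := t - δ) haB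
      rwa [Nat.sub_add_cancel ht] at this
    refine le_inf h1 ?_
    rintro _ ⟨v, -, rfl⟩
    rw [LinearMap.mulLeft_apply, mul_comm]
    exact hN v a haN
  have h2 := Submodule.finrank_mono hle
  have h3 := hilbI_add_finrank_inf (d₀ := d₀) (d₁ := d₁) (D₀ := D₀) (D₁ := D₁) N t
  have h4 := hilbI_add_finrank_inf (d₀ := d₀) (d₁ := d₁) (D₀ := D₀) (D₁ := D₁) (J.restrictScalars ℂ) (t - δ)
  have h5 := hilbI_add_finrank_inf (d₀ := d₀) (d₁ := d₁) (D₀ := D₀) (D₁ := D₁) (N ⊓ J.restrictScalars ℂ) t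
  have h6 := finrank_inf_le (d₀ := d₀) (d₁ := d₁) (D₀ := D₀) (D₁ := D₁) (J.restrictScalars ℂ) t
  omega

/-! ### The lossy Bézout bound along a chain of non-zero-divisors -/

/-- **Doubling trick**: a monotone `ℕ`-valued function satisfies
`(t+1)·f(t) ≤ ∑_{s ≤ 2t+1} f(s)`. [folklore] -/
theorem mul_le_sum_of_monotone {f : ℕ → ℕ} (hf : Monotone f) (t : ℕ) :
    (t + 1) * f t ≤ ∑ s ∈ Finset.range (2 * t + 2), f s := by
  have h1 : ∑ s ∈ Finset.Ico (t + 1) (2 * t + 2), f t ≤ ∑ s ∈ Finset.Ico (t + 1) (2 * t + 2), f s :=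
    Finset.sum_le_sum fun s hs => hf (by rw [Finset.mem_Ico] at hs; omega)
  rw [Finset.sum_const, Nat.card_Ico, smul_eq_mul, show 2 * t + 2 - (t + 1) = t + 1 by omega] at h1
  refine h1.trans ?_
  rw [Finset.range_eq_Ico]
  exact Finset.sum_le_sum_of_subset_of_nonneg (Finset.Ico_subset_Ico (Nat.zero_le _) le_rfl)
    fun _ _ _ => Nat.zero_le _

/-- One step of the lossy Bézout bound: if `Q ∈ Box(1)` is a non-zero-divisor modulo `J ≠ (1)` and
`J + (Q) ≤ J'`, then `(t+1)·H_{J'}(t) ≤ H_J(2t+1)`. [folklore] -/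
theorem succ_mul_hilbI_le {J J' : Ideal (MvPolynomial (Fin d₀ ⊕ Fin d₁) ℂ)} (hJ : J ≠ ⊤)
    {Q : MvPolynomial (Fin d₀ ⊕ Fin d₁) ℂ} (hQB : Q ∈ Box (d₀ := d₀) (d₁ := d₁) D₀ D₁ 1) (hQ : IsNZDMod J Q)
    (hJ' : J ⊔ Ideal.span {Q} ≤ J') (t : ℕ) :
    (t + 1) * hilbI (d₀ := d₀) (d₁ := d₁) D₀ D₁ (J'.restrictScalars ℂ) t ≤ hilbI D₀ D₁ (J.restrictScalars ℂ) (2 * t + 1) := by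
  have hmono : Monotone fun s => hilbI (d₀ := d₀) (d₁ := d₁) D₀ D₁ (J'.restrictScalars ℂ) s :=
    fun s s' h => hilbI_mono _ h
  refine (mul_le_sum_of_monotone hmono t).trans ?_
  have hsum := sum_hilbI_le (d₀ := d₀) (d₁ := d₁) (D₀ := D₀) (D₁ := D₁)
    (J := (J ⊔ Ideal.span {Q}).restrictScalars ℂ) (P := J.restrictScalars ℂ)
    (fun x hx => Ideal.mem_sup_left hx) (fun s hs => hilbI_sup_span_add_le_of_nzd hJ hQB hQ hs) (2 * t + 1)
  refine le_trans (Finset.sum_le_sum fun s _ => ?_) hsum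
  exact hilbI_antitone (d₀ := d₀) (d₁ := d₁) (D₀ := D₀) (D₁ := D₁) (fun x hx => hJ' hx) s

/-- `H_{(0)}(t) = dim Box(t) = (tD₀+1)^{d₀}(tD₁+1)^{d₁} ≤ D₀^{d₀} D₁^{d₁} (t+1)^{d₀+d₁}` for
`D₀, D₁ ≥ 1`. [folklore] -/
theorem hilbI_bot_le (hD₀ : 1 ≤ D₀) (hD₁ : 1 ≤ D₁) (t : ℕ) :
    hilbI (d₀ := d₀) (d₁ := d₁) D₀ D₁ ((⊥ : Ideal (MvPolynomial (Fin d₀ ⊕ Fin d₁) ℂ)).restrictScalars ℂ) t ≤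
      D₀ ^ d₀ * D₁ ^ d₁ * (t + 1) ^ (d₀ + d₁) := by
  have h : hilbI (d₀ := d₀) (d₁ := d₁) D₀ D₁ ((⊥ : Ideal (MvPolynomial (Fin d₀ ⊕ Fin d₁) ℂ)).restrictScalars ℂ) t =
      (t * D₀ + 1) ^ d₀ * (t * D₁ + 1) ^ d₁ := by
    rw [← hilb_univ (d₀ := d₀) (d₁ := d₁) (D₀ := D₀) (D₁ := D₁) t, hilb, vanishing_univ]
  rw [h, pow_add]
  have h1 : (t * D₀ + 1) ^ d₀ ≤ (D₀ * (t + 1)) ^ d₀ := Nat.pow_le_pow_left (by nlinarith) d₀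
  have h2 : (t * D₁ + 1) ^ d₁ ≤ (D₁ * (t + 1)) ^ d₁ := Nat.pow_le_pow_left (by nlinarith) d₁
  calc (t * D₀ + 1) ^ d₀ * (t * D₁ + 1) ^ d₁ ≤ (D₀ * (t + 1)) ^ d₀ * (D₁ * (t + 1)) ^ d₁ :=
        Nat.mul_le_mul h1 h2
    _ = D₀ ^ d₀ * D₁ ^ d₁ * ((t + 1) ^ d₀ * (t + 1) ^ d₁) := by rw [mul_pow, mul_pow]; ring

/-- **The lossy Bézout bound along a chain.** Let `𝔍 : ℕ → Ideal` be a chain starting at `(0)`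
with `𝔍 j + (Q (j+1)) ≤ 𝔍 (j+1)`, `Q (j+1) ∈ Box(1)` a non-zero-divisor modulo `𝔍 j ≠ (1)` for
`j < r`. Then for `j ≤ r`, `j ≤ d = d₀ + d₁`:
`H_{𝔍 j}(t) ≤ 2^{d j} · D₀^{d₀} D₁^{d₁} · (t+1)^{d-j}` — each proper cut by a box-degree-one
non-zero-divisor lowers the growth order by one, at the price of a factor `2^{d}` in the constant
(Roy's Prop. 2.2 has the sharp constant; for Philippon's theorem any constant depending on `d₀, d₁`
suffices). [cite: NesterenkoPhilippon2001, Ch. 11 Prop. 2.2 (lossy form)] -/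
theorem hilbI_chain_le (hD₀ : 1 ≤ D₀) (hD₁ : 1 ≤ D₁) (𝔍 : ℕ → Ideal (MvPolynomial (Fin d₀ ⊕ Fin d₁) ℂ))
    (Q : ℕ → MvPolynomial (Fin d₀ ⊕ Fin d₁) ℂ) (r : ℕ) (h0 : 𝔍 0 = ⊥)
    (hne : ∀ j < r, 𝔍 j ≠ ⊤) (hQB : ∀ j < r, Q (j + 1) ∈ Box (d₀ := d₀) (d₁ := d₁) D₀ D₁ 1)
    (hQ : ∀ j < r, IsNZDMod (𝔍 j) (Q (j + 1))) (hstep : ∀ j < r, 𝔍 j ⊔ Ideal.span {Q (j + 1)} ≤ 𝔍 (j + 1)) :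
    ∀ j, j ≤ r → j ≤ d₀ + d₁ → ∀ t,
      hilbI (d₀ := d₀) (d₁ := d₁) D₀ D₁ ((𝔍 j).restrictScalars ℂ) t ≤
        2 ^ ((d₀ + d₁) * j) * (D₀ ^ d₀ * D₁ ^ d₁) * (t + 1) ^ (d₀ + d₁ - j) := by
  intro j
  induction j with
  | zero =>
    intro _ _ t
    rw [h0]
    simpa [mul_assoc] using hilbI_bot_le (d₀ := d₀) (d₁ := d₁) hD₀ hD₁ t
  | succ j ih =>
    intro hjr hjn t
    have hj : j < r := by omega
    have hstep' := succ_mul_hilbI_le (D₀ := D₀) (D₁ := D₁) (hne j hj) (hQB j hj) (hQ j hj) (hstep j hj) t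
    have hih := ih (by omega) (by omega) (2 * t + 1)
    -- `(t+1) H_{j+1}(t) ≤ H_j(2t+1) ≤ 2^{dj} D₀^{d₀}D₁^{d₁} (2t+2)^{d-j}`
    have e1 : (2 * t + 1 + 1) ^ (d₀ + d₁ - j) = 2 ^ (d₀ + d₁ - j) * (t + 1) ^ (d₀ + d₁ - 1 - j) * (t + 1) := by
      rw [show 2 * t + 1 + 1 = 2 * (t + 1) by ring, mul_pow, show d₀ + d₁ - j = (d₀ + d₁ - 1 - j) + 1 by omega,
        pow_succ]
      ring
    rw [e1] at hih
    have h3 : (t + 1) * hilbI (d₀ := d₀) (d₁ := d₁) D₀ D₁ ((𝔍 (j + 1)).restrictScalars ℂ) t ≤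
        (t + 1) * (2 ^ ((d₀ + d₁) * (j + 1)) * (D₀ ^ d₀ * D₁ ^ d₁) * (t + 1) ^ (d₀ + d₁ - (j + 1))) := by
      refine (hstep'.trans hih).trans ?_
      rw [show d₀ + d₁ - (j + 1) = d₀ + d₁ - 1 - j by omega]
      have h2pow : 2 ^ ((d₀ + d₁) * j) * 2 ^ (d₀ + d₁ - j) ≤ 2 ^ ((d₀ + d₁) * (j + 1)) := by
        rw [← pow_add]
        exact Nat.pow_le_pow_right (by norm_num) (by rw [Nat.mul_succ]; omega)
      calc 2 ^ ((d₀ + d₁) * j) * (D₀ ^ d₀ * D₁ ^ d₁) * (2 ^ (d₀ + d₁ - j) * (t + 1) ^ (d₀ + d₁ - 1 - j) * (t + 1))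
          = (t + 1) * ((2 ^ ((d₀ + d₁) * j) * 2 ^ (d₀ + d₁ - j)) * (D₀ ^ d₀ * D₁ ^ d₁) * (t + 1) ^ (d₀ + d₁ - 1 - j)) := by
            ring
        _ ≤ (t + 1) * (2 ^ ((d₀ + d₁) * (j + 1)) * (D₀ ^ d₀ * D₁ ^ d₁) * (t + 1) ^ (d₀ + d₁ - 1 - j)) :=
          Nat.mul_le_mul_left _ (Nat.mul_le_mul_right _ (Nat.mul_le_mul_right _ h2pow))
    exact Nat.le_of_mul_le_mul_left h3 (Nat.succ_pos t)

end LinGroup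

end Literature.NumberTheory.Transcendental

noncomputable section

open MvPolynomial Module

namespace Literature.NumberTheory.Transcendental

namespace LinGroup

variable {d₀ d₁ : ℕ} {D₀ D₁ : ℕ}

/-- **The component of `I` at the prime `𝔭`**: `loc 𝔭 h𝔭 I = I·B_𝔭 ∩ B = {f ; ∃ P ∉ 𝔭, P·f ∈ I}`.
[cite: NesterenkoPhilippon2001, Ch. 11 §2.3 (86)] -/
def loc (𝔭 : Ideal (MvPolynomial (Fin d₀ ⊕ Fin d₁) ℂ)) (h𝔭 : 𝔭.IsPrime) (I : Ideal (MvPolynomial (Fin d₀ ⊕ Fin d₁) ℂ)) :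
    Ideal (MvPolynomial (Fin d₀ ⊕ Fin d₁) ℂ) where
  carrier := {f | ∃ P ∉ 𝔭, P * f ∈ I}
  zero_mem' := ⟨1, fun h => h𝔭.ne_top ((Ideal.eq_top_iff_one _).mpr h), by simp⟩
  add_mem' := by
    rintro f g ⟨P, hP, hPf⟩ ⟨Q, hQ, hQg⟩
    refine ⟨P * Q, fun h => (h𝔭.mem_or_mem h).elim hP hQ, ?_⟩
    rw [mul_add]
    refine I.add_mem ?_ ?_
    · rw [mul_comm P Q, mul_assoc]; exact I.mul_mem_left Q hPf
    · rw [mul_assoc]; exact I.mul_mem_left P hQg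
  smul_mem' := by
    rintro c f ⟨P, hP, hPf⟩
    refine ⟨P, hP, ?_⟩
    rw [smul_eq_mul, mul_left_comm]
    exact I.mul_mem_left c hPf

section Loc

variable {𝔭 : Ideal (MvPolynomial (Fin d₀ ⊕ Fin d₁) ℂ)} (h𝔭 : 𝔭.IsPrime) {I J : Ideal (MvPolynomial (Fin d₀ ⊕ Fin d₁) ℂ)}

/-- Membership in the component. [folklore] -/
theorem mem_loc_iff {f : MvPolynomial (Fin d₀ ⊕ Fin d₁) ℂ} : f ∈ loc 𝔭 h𝔭 I ↔ ∃ P ∉ 𝔭, P * f ∈ I := Iff.rfl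

/-- `I ≤ loc 𝔭 I`. [folklore] -/
theorem le_loc (I : Ideal (MvPolynomial (Fin d₀ ⊕ Fin d₁) ℂ)) : I ≤ loc 𝔭 h𝔭 I := fun f hf =>
  ⟨1, fun h => h𝔭.ne_top ((Ideal.eq_top_iff_one _).mpr h), by simpa using hf⟩

/-- `loc 𝔭` is monotone. [folklore] -/
theorem loc_mono (h : I ≤ J) : loc 𝔭 h𝔭 I ≤ loc 𝔭 h𝔭 J := fun _ ⟨P, hP, hPf⟩ => ⟨P, hP, h hPf⟩

/-- `loc 𝔭` is idempotent. [folklore] -/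
theorem loc_loc (I : Ideal (MvPolynomial (Fin d₀ ⊕ Fin d₁) ℂ)) : loc 𝔭 h𝔭 (loc 𝔭 h𝔭 I) = loc 𝔭 h𝔭 I := by
  refine le_antisymm ?_ (le_loc h𝔭 _)
  rintro f ⟨P, hP, Q, hQ, hQPf⟩
  refine ⟨Q * P, fun h => (h𝔭.mem_or_mem h).elim hQ hP, ?_⟩
  rwa [mul_assoc]

/-- `I ≤ 𝔭 ⇒ loc 𝔭 I ≤ 𝔭`. [folklore] -/
theorem loc_le (h : I ≤ 𝔭) : loc 𝔭 h𝔭 I ≤ 𝔭 := fun _ ⟨_, hP, hPf⟩ =>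
  (h𝔭.mem_or_mem (h hPf)).resolve_left hP

/-- `loc 𝔭 I` is proper when `I ≤ 𝔭`. [folklore] -/
theorem loc_ne_top (h : I ≤ 𝔭) : loc 𝔭 h𝔭 I ≠ ⊤ := fun htop =>
  h𝔭.ne_top (top_le_iff.mp (htop ▸ loc_le h𝔭 h))

/-- **Elements outside `𝔭` are non-zero-divisors modulo `loc 𝔭 I`.** [folklore] -/
theorem isNZDMod_loc (I : Ideal (MvPolynomial (Fin d₀ ⊕ Fin d₁) ℂ)) {Q : MvPolynomial (Fin d₀ ⊕ Fin d₁) ℂ}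
    (hQ : Q ∉ 𝔭) : IsNZDMod (loc 𝔭 h𝔭 I) Q := by
  rintro f ⟨P, hP, hPQf⟩
  refine ⟨P * Q, fun h => (h𝔭.mem_or_mem h).elim hP hQ, ?_⟩
  rwa [mul_assoc]

/-- If `P ∉ 𝔭` and `(P f)^e ∈ I` then `f^e ∈ loc 𝔭 I`. [folklore] -/
theorem pow_mem_loc {f P : MvPolynomial (Fin d₀ ⊕ Fin d₁) ℂ} (hP : P ∉ 𝔭) {e : ℕ} (h : (P * f) ^ e ∈ I) :
    f ^ e ∈ loc 𝔭 h𝔭 I :=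
  ⟨P ^ e, fun h' => hP (h𝔭.mem_of_pow_mem _ h'), by rwa [← mul_pow]⟩

end Loc

/-- A non-zero-divisor modulo each member of a finite family of ideals is one modulo their
intersection. [folklore] -/
theorem isNZDMod_finsetInf {ι : Type*} (S : Finset ι) (J : ι → Ideal (MvPolynomial (Fin d₀ ⊕ Fin d₁) ℂ))
    {Q : MvPolynomial (Fin d₀ ⊕ Fin d₁) ℂ} (h : ∀ i ∈ S, IsNZDMod (J i) Q) : IsNZDMod (S.inf J) Q := by
  classical
  induction S using Finset.induction_on with
  | empty => intro f _; simp
  | insert a S ha ih =>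
    intro f hf
    rw [Finset.inf_insert, Ideal.mem_inf] at hf ⊢
    exact ⟨h a (Finset.mem_insert_self a S) f hf.1,
      ih (fun i hi => h i (Finset.mem_insert_of_mem hi)) f hf.2⟩

/-- A product of elements outside a prime is outside it. [folklore] -/
theorem prod_notMem_of_isPrime {ι : Type*} {𝔭 : Ideal (MvPolynomial (Fin d₀ ⊕ Fin d₁) ℂ)} (h𝔭 : 𝔭.IsPrime)
    (S : Finset ι) (b : ι → MvPolynomial (Fin d₀ ⊕ Fin d₁) ℂ) (hb : ∀ i ∈ S, b i ∉ 𝔭) : ∏ i ∈ S, b i ∉ 𝔭 := by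
  classical
  induction S using Finset.induction_on with
  | empty => simpa using fun h => h𝔭.ne_top ((Ideal.eq_top_iff_one _).mpr h)
  | insert a S ha ih =>
    rw [Finset.prod_insert ha]
    intro h
    rcases h𝔭.mem_or_mem h with h1 | h1
    · exact hb a (Finset.mem_insert_self a S) h1
    · exact ih (fun i hi => hb i (Finset.mem_insert_of_mem hi)) h1

/-! ### Thick additivity -/

/-- **Thick additivity.** Let `𝔭ᵢ` (`i ∈ S`) be pairwise incomparable primes containing `I` with
`𝔭ᵢ^{Mᵢ} ≤ loc 𝔭ᵢ I` (as when `𝔭ᵢ` is minimal over `I`). Then there is a shift `δ` with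
`∑_{i ∈ S} H_{loc 𝔭ᵢ I}(t - δ) ≤ H_{⋂_{i ∈ S} loc 𝔭ᵢ I}(t)` for all `t ≥ δ` (`D₀, D₁ ≥ 1`).
[cite: NesterenkoPhilippon2001, Ch. 11 §2.2 (ii)] -/
theorem exists_sum_hilbI_loc_le (hD₀ : 1 ≤ D₀) (hD₁ : 1 ≤ D₁) (I : Ideal (MvPolynomial (Fin d₀ ⊕ Fin d₁) ℂ))
    {ι : Type*} (𝔭 : ι → Ideal (MvPolynomial (Fin d₀ ⊕ Fin d₁) ℂ)) (h𝔭 : ∀ i, (𝔭 i).IsPrime)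
    (hinc : ∀ i j, 𝔭 i ≤ 𝔭 j → i = j) (hI : ∀ i, I ≤ 𝔭 i)
    (hrad : ∀ i, ∃ M : ℕ, 𝔭 i ^ M ≤ loc (𝔭 i) (h𝔭 i) I) (S : Finset ι) :
    ∃ δ : ℕ, ∀ t, δ ≤ t →
      ∑ i ∈ S, hilbI (d₀ := d₀) (d₁ := d₁) D₀ D₁ ((loc (𝔭 i) (h𝔭 i) I).restrictScalars ℂ) (t - δ) ≤
        hilbI D₀ D₁ ((S.inf fun i => loc (𝔭 i) (h𝔭 i) I).restrictScalars ℂ) t := by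
  classical
  induction S using Finset.induction_on with
  | empty => exact ⟨0, fun t _ => by simp⟩
  | insert i₀ S hi₀ ih =>
    obtain ⟨δ, hδ⟩ := ih
    -- an element of `⋂_{S} loc 𝔭ᵢ I` outside `𝔭 i₀`: a product of powers of elements `xᵢ ∈ 𝔭ᵢ \ 𝔭 i₀`
    have hx : ∀ i ∈ S, ∃ b : MvPolynomial (Fin d₀ ⊕ Fin d₁) ℂ, b ∈ loc (𝔭 i) (h𝔭 i) I ∧ b ∉ 𝔭 i₀ := by
      intro i hi
      have hne : i ≠ i₀ := fun h => hi₀ (h ▸ hi)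
      have hnot : ¬ (𝔭 i ≤ 𝔭 i₀) := fun hle => hne (hinc i i₀ hle)
      obtain ⟨x, hxi, hxi₀⟩ := Set.not_subset.mp hnot
      obtain ⟨M, hM⟩ := hrad i
      exact ⟨x ^ M, hM (Ideal.pow_mem_pow hxi M), fun h => hxi₀ ((h𝔭 i₀).mem_of_pow_mem _ h)⟩
    choose! b hb using hx
    set a : MvPolynomial (Fin d₀ ⊕ Fin d₁) ℂ := ∏ i ∈ S, b i with ha
    have haN : a ∈ S.inf fun i => loc (𝔭 i) (h𝔭 i) I := by
      refine Submodule.mem_finsetInf.mpr fun i hi => ?_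
      rw [ha, ← Finset.mul_prod_erase S b hi]
      exact Ideal.mul_mem_right _ _ (hb i hi).1
    have ha𝔭 : a ∉ 𝔭 i₀ := prod_notMem_of_isPrime (h𝔭 i₀) S b fun i hi => (hb i hi).2
    set δ' := a.totalDegree with hδ'
    have haB : a ∈ Box (d₀ := d₀) (d₁ := d₁) D₀ D₁ δ' := mem_Box_totalDegree hD₀ hD₁ a
    refine ⟨δ + δ', fun t ht => ?_⟩
    rw [Finset.sum_insert hi₀, Finset.inf_insert]
    have key := hilbI_add_le_hilbI_inf_of_nzd (D₀ := D₀) (D₁ := D₁)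
      (N := (S.inf fun i => loc (𝔭 i) (h𝔭 i) I).restrictScalars ℂ) (J := loc (𝔭 i₀) (h𝔭 i₀) I)
      (loc_ne_top (h𝔭 i₀) (hI i₀)) haB haN (fun x y hy => Ideal.mul_mem_left _ x hy)
      (isNZDMod_loc (h𝔭 i₀) I ha𝔭) (t := t) (by omega)
    have hrs : (S.inf fun i => loc (𝔭 i) (h𝔭 i) I).restrictScalars ℂ ⊓ (loc (𝔭 i₀) (h𝔭 i₀) I).restrictScalars ℂ =
        (loc (𝔭 i₀) (h𝔭 i₀) I ⊓ S.inf fun i => loc (𝔭 i) (h𝔭 i) I).restrictScalars ℂ := by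
      rw [inf_comm, Submodule.restrictScalars_inf]
    rw [hrs] at key
    have h1 := hδ t (by omega)
    have h2 : ∑ i ∈ S, hilbI (d₀ := d₀) (d₁ := d₁) D₀ D₁ ((loc (𝔭 i) (h𝔭 i) I).restrictScalars ℂ) (t - (δ + δ')) ≤
        ∑ i ∈ S, hilbI (d₀ := d₀) (d₁ := d₁) D₀ D₁ ((loc (𝔭 i) (h𝔭 i) I).restrictScalars ℂ) (t - δ) :=
      Finset.sum_le_sum fun i _ => hilbI_mono _ (by omega)
    have h3 : hilbI (d₀ := d₀) (d₁ := d₁) D₀ D₁ ((loc (𝔭 i₀) (h𝔭 i₀) I).restrictScalars ℂ) (t - (δ + δ')) ≤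
        hilbI D₀ D₁ ((loc (𝔭 i₀) (h𝔭 i₀) I).restrictScalars ℂ) (t - δ') := hilbI_mono _ (by omega)
    omega

end LinGroup

end Literature.NumberTheory.Transcendental

noncomputable section

open MvPolynomial IsLocalRing RingTheory.Sequence

namespace Literature.NumberTheory.Transcendental

namespace LinGroup

open Literature.AlgebraicGeometry.Resolution

variable {d₀ d₁ : ℕ}

/-- Avoidance hypothesis in `B` relative to the prime `𝔭`: each `Q_{l+1}` lies outside every
minimal prime `𝔭' ⊆ 𝔭` of `(Q₁, …, Q_l)`. [folklore] -/
def AvoidsMinimalPrimesBelow (𝔭 : Ideal (MvPolynomial (Fin d₀ ⊕ Fin d₁) ℂ)) (Q : List (MvPolynomial (Fin d₀ ⊕ Fin d₁) ℂ)) :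
    Prop :=
  ∀ (L₁ : List (MvPolynomial (Fin d₀ ⊕ Fin d₁) ℂ)) (q : MvPolynomial (Fin d₀ ⊕ Fin d₁) ℂ)
    (L₂ : List (MvPolynomial (Fin d₀ ⊕ Fin d₁) ℂ)), Q = L₁ ++ q :: L₂ →
    ∀ 𝔭' ∈ (Ideal.ofList L₁).minimalPrimes, 𝔭' ≤ 𝔭 → q ∉ 𝔭'

section AtPrime

variable (𝔭 : Ideal (MvPolynomial (Fin d₀ ⊕ Fin d₁) ℂ)) [h𝔭 : 𝔭.IsPrime]

/-- The avoidance hypothesis passes to the localisation `B_𝔭`. [folklore] -/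
theorem avoidsMinimalPrimes_map_atPrime {Q : List (MvPolynomial (Fin d₀ ⊕ Fin d₁) ℂ)} (hav : AvoidsMinimalPrimesBelow 𝔭 Q) :
    AvoidsMinimalPrimes (Q.map (algebraMap (MvPolynomial (Fin d₀ ⊕ Fin d₁) ℂ) (Localization.AtPrime 𝔭))) := by
  intro M₁ x M₂ hdec 𝔓 h𝔓 hx
  set f := algebraMap (MvPolynomial (Fin d₀ ⊕ Fin d₁) ℂ) (Localization.AtPrime 𝔭) with hf
  obtain ⟨L₁, L, rfl, hL₁, hL⟩ := List.map_eq_append_iff.mp hdec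
  obtain ⟨q, L₂, rfl, hq, hL₂⟩ := List.map_eq_cons_iff.mp hL
  have h𝔓p : 𝔓.IsPrime := h𝔓.1.1
  rw [← hL₁, ← Ideal.map_ofList, IsLocalization.minimalPrimes_map 𝔭.primeCompl] at h𝔓
  -- `𝔓 ∩ B` is a minimal prime of `(L₁)`, it is contained in `𝔭`, and it contains `q`
  have h1 : 𝔓.under (MvPolynomial (Fin d₀ ⊕ Fin d₁) ℂ) ∈ (Ideal.ofList L₁).minimalPrimes := h𝔓
  have hdisj := ((IsLocalization.isPrime_iff_isPrime_disjoint 𝔭.primeCompl (Localization.AtPrime 𝔭) 𝔓).mp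
    h𝔓p).2
  have hle : 𝔓.under (MvPolynomial (Fin d₀ ⊕ Fin d₁) ℂ) ≤ 𝔭 := fun y hy => by
    by_contra hy𝔭
    exact Set.disjoint_left.mp hdisj (show y ∈ (𝔭.primeCompl : Set _) from hy𝔭) hy
  refine hav L₁ q L₂ rfl _ h1 hle ?_
  rw [Ideal.under_def, Ideal.mem_comap, ← hf, hq]
  exact hx

/-- **Non-zero-divisors modulo components from the Cohen–Macaulay property of `B_𝔭`.** If
`Q₁, …, Q_k ∈ 𝔭` and each `Q_{l+1}` avoids the minimal primes `𝔭' ⊆ 𝔭` of `(Q₁, …, Q_l)`, then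
`Q_{l+1}` is a non-zero-divisor modulo `loc 𝔭 (Q₁, …, Q_l)`.
[cite: NesterenkoPhilippon2001, Ch. 11 Prop. 2.2 (proof)] -/
theorem isNZDMod_loc_ofList {Q : List (MvPolynomial (Fin d₀ ⊕ Fin d₁) ℂ)} (hQ : ∀ q ∈ Q, q ∈ 𝔭)
    (hav : AvoidsMinimalPrimesBelow 𝔭 Q) {L₁ : List (MvPolynomial (Fin d₀ ⊕ Fin d₁) ℂ)}
    {q : MvPolynomial (Fin d₀ ⊕ Fin d₁) ℂ} {L₂ : List (MvPolynomial (Fin d₀ ⊕ Fin d₁) ℂ)} (hdec : Q = L₁ ++ q :: L₂) :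
    IsNZDMod (loc 𝔭 h𝔭 (Ideal.ofList L₁)) q := by
  set R := Localization.AtPrime 𝔭 with hR
  set f := algebraMap (MvPolynomial (Fin d₀ ⊕ Fin d₁) ℂ) R with hf
  -- `R` is a regular local ring, hence Cohen–Macaulay
  obtain ⟨rs, hrs, hmem, hlen⟩ := exists_isRegular_length_eq_ringKrullDim R
  have hQm : ∀ x ∈ Q.map f, x ∈ maximalIdeal R := by
    intro x hx
    obtain ⟨q', hq', rfl⟩ := List.mem_map.mp hx
    exact (IsLocalization.AtPrime.to_map_mem_maximal_iff R 𝔭 q').mpr (hQ q' hq')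
  have hreg : IsRegular R (Q.map f) :=
    isRegular_of_forall_notMem_minimalPrimes hrs hmem hlen hQm (avoidsMinimalPrimes_map_atPrime 𝔭 hav)
  -- regularity of `f q` on `R ⧸ (L₁)R`
  have hw := hreg.toIsWeaklyRegular
  rw [hdec, List.map_append, List.map_cons, isWeaklyRegular_append_iff, isWeaklyRegular_cons_iff] at hw
  obtain ⟨-, hsm, -⟩ := hw
  intro g hg
  obtain ⟨P, hP, hPqg⟩ := hg
  set N : Submodule R R := Ideal.ofList (L₁.map f) • ⊤ with hN
  have hNeq : N = (((Ideal.ofList L₁).map f : Ideal R) : Submodule R R) := by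
    rw [hN, smul_eq_mul, Ideal.mul_top, Ideal.map_ofList]
  have hx0 : (Submodule.Quotient.mk (f (P * g)) : R ⧸ N) = 0 := by
    refine hsm.right_eq_zero_of_smul ?_
    rw [← Submodule.Quotient.mk_smul, smul_eq_mul, ← map_mul, Submodule.Quotient.mk_eq_zero, hNeq]
    have e : q * (P * g) = P * (q * g) := by ring
    rw [e]
    exact Ideal.mem_map_of_mem f hPqg
  rw [Submodule.Quotient.mk_eq_zero, hNeq] at hx0
  have hx1 : f (P * g) ∈ (Ideal.ofList L₁).map f := hx0
  rw [hf, IsLocalization.algebraMap_mem_map_algebraMap_iff 𝔭.primeCompl] at hx1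
  obtain ⟨m, hm, hmPg⟩ := hx1
  exact ⟨m * P, fun h => (h𝔭.mem_or_mem h).elim hm hP, by rwa [mul_assoc]⟩

end AtPrime

end LinGroup

end Literature.NumberTheory.Transcendental

noncomputable section

open MvPolynomial Module

namespace Literature.NumberTheory.Transcendental

namespace LinGroup

variable {d₀ d₁ : ℕ} {D₀ D₁ : ℕ}

/-! ### Avoiding finitely many primes inside a subspace -/

/-- A `ℂ`-subspace of `B` not contained in any of finitely many ideals `𝔭' ∈ 𝓑` has an element
outside all of them (a vector space over an infinite field is not a finite union of proper
subspaces). [folklore] -/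
theorem exists_mem_forall_notMem_of_not_subset (V : Submodule ℂ (MvPolynomial (Fin d₀ ⊕ Fin d₁) ℂ))
    {𝓑 : Set (Ideal (MvPolynomial (Fin d₀ ⊕ Fin d₁) ℂ))} (h𝓑 : 𝓑.Finite)
    (h : ∀ 𝔭' ∈ 𝓑, ¬ ((V : Set (MvPolynomial (Fin d₀ ⊕ Fin d₁) ℂ)) ⊆ 𝔭')) :
    ∃ Q ∈ V, ∀ 𝔭' ∈ 𝓑, Q ∉ 𝔭' := by
  by_contra hcon
  push Not at hcon
  haveI : Finite ↥𝓑 := h𝓑.to_subtype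
  let p : ↥𝓑 → Submodule ℂ ↥V := fun b => ((b.1 : Ideal _).restrictScalars ℂ).comap V.subtype
  have hcov : ⋃ b, (p b : Set ↥V) = Set.univ := by
    refine Set.eq_univ_of_forall fun v => ?_
    obtain ⟨𝔭', h𝔭', hv⟩ := hcon v v.2
    exact Set.mem_iUnion.mpr ⟨⟨𝔭', h𝔭'⟩, hv⟩
  obtain ⟨b, hb⟩ := Subspace.exists_eq_top_of_iUnion_eq_univ hcov
  refine h b.1 b.2 fun x hx => ?_
  have : (⟨x, hx⟩ : ↥V) ∈ p b := by rw [hb]; trivial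
  exact this

/-! ### The generic sequence -/

/-- Appending one element to a list: decompositions of `Qs ++ [Q]`. [folklore] -/
theorem append_singleton_eq_append_cons {α : Type*} {Qs L₁ L₂ : List α} {Q q : α}
    (h : Qs ++ [Q] = L₁ ++ q :: L₂) : (L₁ = Qs ∧ q = Q ∧ L₂ = []) ∨ ∃ L₂', Qs = L₁ ++ q :: L₂' := by
  rcases List.append_eq_append_iff.mp h with ⟨a', h1, h2⟩ | ⟨c', h1, h2⟩
  · -- `L₁ = Qs ++ a'`, `[Q] = a' ++ q :: L₂`
    cases a' with
    | nil =>
      simp only [List.nil_append, List.cons.injEq, List.append_nil] at h1 h2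
      obtain ⟨h3, h4⟩ := h2
      left
      exact ⟨by rw [h1], by rw [h3], by rw [← h4]⟩
    | cons x xs => simp at h2
  · -- `Qs = L₁ ++ c'`, `q :: L₂ = c' ++ [Q]`
    cases c' with
    | nil =>
      simp only [List.append_nil, List.nil_append, List.cons.injEq] at h1 h2
      obtain ⟨h3, h4⟩ := h2
      left
      exact ⟨by rw [h1], by rw [h3], by rw [h4]⟩
    | cons x xs =>
      simp only [List.cons_append, List.cons.injEq] at h2
      obtain ⟨rfl, -⟩ := h2
      exact Or.inr ⟨xs, h1⟩

variable {ι : Type*} [Fintype ι] (𝔭 : ι → Ideal (MvPolynomial (Fin d₀ ⊕ Fin d₁) ℂ)) (h𝔭 : ∀ i, (𝔭 i).IsPrime)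
  (Fset : Finset (MvPolynomial (Fin d₀ ⊕ Fin d₁) ℂ)) (r : ℕ)
  (hDH : ∀ 𝔭' : Ideal (MvPolynomial (Fin d₀ ⊕ Fin d₁) ℂ), 𝔭'.IsPrime → (∃ i, 𝔭' ≤ 𝔭 i) →
    (↑Fset : Set (MvPolynomial (Fin d₀ ⊕ Fin d₁) ℂ)) ⊆ 𝔭' → (r : ℕ∞) ≤ 𝔭'.height)

omit [Fintype ι] in
include hDH in
/-- **The generic sequence**: `Q₁, …, Q_j ∈ span F` (`j ≤ r`) with each `Q_{l+1}` outside every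
minimal prime `𝔭' ⊆ 𝔭ᵢ` of `(Q₁, …, Q_l)`. [cite: NesterenkoPhilippon2001, Ch. 11 Prop. 2.2 (proof)] -/
theorem exists_list_avoids : ∀ j ≤ r, ∃ Qs : List (MvPolynomial (Fin d₀ ⊕ Fin d₁) ℂ), Qs.length = j ∧
    (∀ Q ∈ Qs, Q ∈ Submodule.span ℂ (↑Fset : Set (MvPolynomial (Fin d₀ ⊕ Fin d₁) ℂ))) ∧
    ∀ i, AvoidsMinimalPrimesBelow (𝔭 i) Qs := by
  intro j
  induction j with
  | zero =>
    intro _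
    refine ⟨[], rfl, fun Q hQ => by simp at hQ, fun i L₁ q L₂ h => ?_⟩
    exact absurd h (by simp)
  | succ j ih =>
    intro hj
    obtain ⟨Qs, hlen, hspan, hav⟩ := ih (by omega)
    -- the bad primes: minimal primes of `(Qs)` below some `𝔭 i`
    set 𝓑 : Set (Ideal (MvPolynomial (Fin d₀ ⊕ Fin d₁) ℂ)) :=
      {𝔭' | 𝔭' ∈ (Ideal.ofList Qs).minimalPrimes ∧ ∃ i, 𝔭' ≤ 𝔭 i} with h𝓑
    have h𝓑fin : 𝓑.Finite :=
      (Ideal.finite_minimalPrimes_of_isNoetherianRing _ (Ideal.ofList Qs)).subset fun _ h => h.1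
    have hnot : ∀ 𝔭' ∈ 𝓑, ¬ ((Submodule.span ℂ (↑Fset : Set (MvPolynomial (Fin d₀ ⊕ Fin d₁) ℂ)) :
        Set (MvPolynomial (Fin d₀ ⊕ Fin d₁) ℂ)) ⊆ 𝔭') := by
      rintro 𝔭' ⟨h𝔭'min, hi⟩ hsub
      have hF : (↑Fset : Set (MvPolynomial (Fin d₀ ⊕ Fin d₁) ℂ)) ⊆ 𝔭' :=
        fun x hx => hsub (Submodule.subset_span hx)
      have h1 := hDH 𝔭' h𝔭'min.1.1 hi hF
      -- Krull: `height 𝔭' ≤ #Qs = j < r`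
      have h2 : 𝔭'.height ≤ ({x | x ∈ Qs} : Set _).ncard :=
        Ideal.height_le_card_of_mem_minimalPrimes_span (List.finite_toSet Qs) h𝔭'min
      have h3 : ({x | x ∈ Qs} : Set (MvPolynomial (Fin d₀ ⊕ Fin d₁) ℂ)).ncard ≤ j := by
        rw [← hlen, show ({x | x ∈ Qs} : Set _) = ↑Qs.toFinset by ext; simp, Set.ncard_coe_finset]
        exact List.toFinset_card_le Qs
      have h4 : (r : ℕ∞) ≤ j := h1.trans (h2.trans (by exact_mod_cast h3))
      have : r ≤ j := by exact_mod_cast h4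
      omega
    obtain ⟨Q, hQ, hQavoid⟩ := exists_mem_forall_notMem_of_not_subset _ h𝓑fin hnot
    refine ⟨Qs ++ [Q], by simp [hlen], fun Q' hQ' => ?_, fun i L₁ q L₂ hdec 𝔭' h𝔭' hle => ?_⟩
    · rw [List.mem_append, List.mem_singleton] at hQ'
      rcases hQ' with h | rfl
      · exact hspan Q' h
      · exact hQ
    · rcases append_singleton_eq_append_cons hdec with ⟨rfl, rfl, rfl⟩ | ⟨L₂', hQs⟩
      · exact hQavoid 𝔭' ⟨h𝔭', i, hle⟩
      · exact hav i L₁ q L₂' hQs 𝔭' h𝔭' hle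

/-! ### The chain and its Hilbert functions -/

omit [Fintype ι] in
/-- `loc 𝔭 (0) = (0)` (`B` is a domain). [folklore] -/
theorem loc_bot (i : ι) : loc (𝔭 i) (h𝔭 i) ⊥ = ⊥ := by
  refine le_antisymm (fun f ⟨P, hP, hPf⟩ => ?_) bot_le
  rw [Ideal.mem_bot] at hPf ⊢
  exact (mul_eq_zero.mp hPf).resolve_left fun h => hP (h ▸ (𝔭 i).zero_mem)

include hDH in
/-- **The ideal of the generic complete intersection, localised at the `𝔭ᵢ`, and its lossy Bézout
bound**: there is `𝔍` with `𝔍 ≤ loc 𝔭ᵢ (F)` for all `i` and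
`H_𝔍(t) ≤ 2^{dr} D₀^{d₀} D₁^{d₁} (t+1)^{d-r}` for all `t` (`d = d₀ + d₁`).
[cite: NesterenkoPhilippon2001, Ch. 11 Prop. 2.2 (lossy form)] -/
theorem exists_ideal_hilbI_le [Nonempty ι] (hD₀ : 1 ≤ D₀) (hD₁ : 1 ≤ D₁) (hr : r ≤ d₀ + d₁)
    (hFBox : (↑Fset : Set (MvPolynomial (Fin d₀ ⊕ Fin d₁) ℂ)) ⊆ (Box (d₀ := d₀) (d₁ := d₁) D₀ D₁ 1 : Set (MvPolynomial (Fin d₀ ⊕ Fin d₁) ℂ)))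
    (hF𝔭 : ∀ i, (↑Fset : Set (MvPolynomial (Fin d₀ ⊕ Fin d₁) ℂ)) ⊆ (𝔭 i : Set (MvPolynomial (Fin d₀ ⊕ Fin d₁) ℂ))) :
    ∃ 𝔍 : Ideal (MvPolynomial (Fin d₀ ⊕ Fin d₁) ℂ),
      (∀ i, 𝔍 ≤ loc (𝔭 i) (h𝔭 i) (Ideal.span (↑Fset : Set (MvPolynomial (Fin d₀ ⊕ Fin d₁) ℂ)))) ∧
      ∀ t, hilbI (d₀ := d₀) (d₁ := d₁) D₀ D₁ (𝔍.restrictScalars ℂ) t ≤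
        2 ^ ((d₀ + d₁) * r) * (D₀ ^ d₀ * D₁ ^ d₁) * (t + 1) ^ (d₀ + d₁ - r) := by
  classical
  obtain ⟨Qs, hlen, hspan, hav⟩ := exists_list_avoids 𝔭 Fset r hDH r le_rfl
  -- basic inclusions
  have hspanBox : Submodule.span ℂ (↑Fset : Set (MvPolynomial (Fin d₀ ⊕ Fin d₁) ℂ)) ≤ Box (d₀ := d₀) (d₁ := d₁) D₀ D₁ 1 :=
    Submodule.span_le.mpr hFBox
  have hspan𝔭 : ∀ i, Submodule.span ℂ (↑Fset : Set (MvPolynomial (Fin d₀ ⊕ Fin d₁) ℂ)) ≤ (𝔭 i).restrictScalars ℂ :=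
    fun i => Submodule.span_le.mpr (hF𝔭 i)
  have hspanI : Submodule.span ℂ (↑Fset : Set (MvPolynomial (Fin d₀ ⊕ Fin d₁) ℂ)) ≤
      (Ideal.span (↑Fset : Set (MvPolynomial (Fin d₀ ⊕ Fin d₁) ℂ))).restrictScalars ℂ :=
    Submodule.span_le.mpr fun x hx => Ideal.subset_span hx
  have hofList : ∀ L : List (MvPolynomial (Fin d₀ ⊕ Fin d₁) ℂ), (∀ Q ∈ L, Q ∈ Qs) →
      ∀ i, Ideal.ofList L ≤ 𝔭 i := fun L hL i => by
    rw [Ideal.ofList, Ideal.span_le]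
    intro Q hQ
    exact hspan𝔭 i (hspan Q (hL Q hQ))
  -- the chain
  let 𝔍 : ℕ → Ideal (MvPolynomial (Fin d₀ ⊕ Fin d₁) ℂ) := fun j =>
    Finset.univ.inf fun i => loc (𝔭 i) (h𝔭 i) (Ideal.ofList (Qs.take j))
  let Q : ℕ → MvPolynomial (Fin d₀ ⊕ Fin d₁) ℂ := fun j => Qs.getD (j - 1) 0
  have hQmem : ∀ j < r, Q (j + 1) ∈ Qs := fun j hj => by
    simp only [Q, Nat.add_sub_cancel]
    rw [List.getD_eq_getElem _ _ (by omega)]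
    exact List.getElem_mem _
  have hdec : ∀ j < r, Qs = Qs.take j ++ Q (j + 1) :: Qs.drop (j + 1) := fun j hj => by
    simp only [Q, Nat.add_sub_cancel]
    rw [List.getD_eq_getElem _ _ (by omega), ← List.drop_eq_getElem_cons (by omega), List.take_append_drop]
  have h0 : 𝔍 0 = ⊥ := by
    show Finset.univ.inf (fun i => loc (𝔭 i) (h𝔭 i) (Ideal.ofList (Qs.take 0))) = ⊥
    simp only [List.take_zero, Ideal.ofList_nil, loc_bot 𝔭 h𝔭]
    exact Finset.inf_const Finset.univ_nonempty _
  have hne : ∀ j < r, 𝔍 j ≠ ⊤ := fun j hj htop => by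
    obtain ⟨i⟩ := ‹Nonempty ι›
    have h1 : 𝔍 j ≤ 𝔭 i := (Finset.inf_le (Finset.mem_univ i)).trans
      (loc_le (h𝔭 i) (hofList _ (fun Q hQ => List.mem_of_mem_take hQ) i))
    exact (h𝔭 i).ne_top (top_le_iff.mp (htop ▸ h1))
  have hQB : ∀ j < r, Q (j + 1) ∈ Box (d₀ := d₀) (d₁ := d₁) D₀ D₁ 1 := fun j hj => hspanBox (hspan _ (hQmem j hj))
  have hQnzd : ∀ j < r, IsNZDMod (𝔍 j) (Q (j + 1)) := fun j hj =>
    isNZDMod_finsetInf _ _ fun i _ => by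
      haveI := h𝔭 i
      exact isNZDMod_loc_ofList (𝔭 i) (fun q hq => hspan𝔭 i (hspan q hq)) (hav i) (hdec j hj)
  have hstep : ∀ j < r, 𝔍 j ⊔ Ideal.span {Q (j + 1)} ≤ 𝔍 (j + 1) := fun j hj => by
    have htake : Qs.take (j + 1) = Qs.take j ++ [Q (j + 1)] := by
      simp only [Q, Nat.add_sub_cancel]
      rw [List.getD_eq_getElem _ _ (by omega), List.take_succ_eq_append_getElem (by omega)]
    refine Finset.le_inf fun i _ => sup_le ((Finset.inf_le (Finset.mem_univ i)).trans (loc_mono (h𝔭 i) ?_)) ?_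
    · rw [htake, Ideal.ofList_append]; exact le_sup_left
    · rw [Ideal.span_singleton_le_iff_mem]
      refine le_loc (h𝔭 i) _ ?_
      rw [htake, Ideal.ofList_append, Ideal.ofList_singleton]
      exact Ideal.mem_sup_right (Ideal.mem_span_singleton_self _)
  have hbound := hilbI_chain_le hD₀ hD₁ 𝔍 Q r h0 hne hQB hQnzd hstep r le_rfl hr
  refine ⟨𝔍 r, fun i => (Finset.inf_le (Finset.mem_univ i)).trans (loc_mono (h𝔭 i) ?_), hbound⟩
  rw [List.take_of_length_le (by omega), Ideal.ofList, Ideal.span_le]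
  intro q hq
  exact hspanI (hspan q hq)

end LinGroup

end Literature.NumberTheory.Transcendental
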